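import Summits.AtomisticToContinuum.FouriersLaw.Theorems.BondHeatUncertaintySubdiffusiveBondHeatJunctionGradedGoodScale

/-!
# Calibration of the graded kernel: the dichotomy «Ohmic or resistance ≤ K_θ·C·N^θ», and sharpness of `θ < 1`

Support file for stmt-AtomisticToContinuum-11071 (`BondHeatUncertainty.BoundedResponse`), decomposition cell `decomp-a2c`, lens-1 (grading /
quantitative ladder), gen 57 — file (12) (imports (11)).

Two calibration facts for the graded one-good-scale kernel of file (11) (`linear_of_bufferedJunctionPow_of_goodScale`,
`boundedResponse_of_bufferedJunctionLawPow_of_escapeInfZeroPow`, `0 ≤ θ < 1`):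

* GRADED DICHOTOMY (per temperature).  Under the `θ`-defect buffered junction inequality at `T` the chain is EITHER Ohmic at `T`
  (`E_N(T) ≤ C₁/N` eventually) OR its resistance is capped by the defect scale at EVERY large `N`:
  `1/E_N(T) ≤ K_θ·C·(N+L₀)^θ` (`ohmicAt_or_resistancePowCapped_of_bufferedJunctionPowAt`; law level
  `ohmicAt_or_resistancePowCapped_of_bufferedJunctionLawPow`, with `(N+L₀)^θ ≤ 2^θ N^θ`).  In the frame's dictionary `D_N = (N−1)γ·E_N` the
  second branch reads `D_N ≥ (N−1)γ/(2^θ K_θ C·N^θ) ≳ N^{1−θ}`: a junction defect of exponent `θ` EXCLUDES the band of anomalous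
  conductance exponents `D_N ≍ N^α`, `0 < α < 1 − θ` — `θ = 0` is file (10)'s «Ohmic or ballistic».
* SHARPNESS OF `θ < 1`.  At `θ = 1` (linear defect) the kernel fails for EVERY chain factor `K`: the sequence
  `r_N = max(N·(S − C·log N), 0)`, `S = |K|·C + c`, is nonnegative, obeys the free-split law with defect `C·(u+v)` (by `log t ≤ t − 1`),
  satisfies the good-scale inequality `K·C·N⋆ + c ≤ r_{N⋆}` at `N⋆ = 1`, and VANISHES for `N ≥ exp(S/C)`
  (`exists_defectOne_goodScale_not_linear`, `not_linear_kernel_at_one`).  So the ladder of file (11) is exactly `θ ∈ [0, 1)`.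

No `sorry`; standard axioms; nothing here closes an item.
-/

noncomputable section

open MeasureTheory Filter Topology Set

namespace Summit.AtomisticToContinuum.FouriersLaw.Theorems.SubdiffusiveBondHeat

namespace EscapeGrading

open Literature.MathematicalPhysics.KineticTheory.HeatConduction
open Summit.AtomisticToContinuum.FouriersLaw.Theses.BondHeatUncertainty (BoundedResponse)

/-! ## The graded dichotomy -/

/-- `0 ≤ K_θ` for `θ < 1` (`ρ = 2^θ/2 < 1`). [folklore] -/
theorem gradedChainFactor_nonneg {θ : ℝ} (hθ : θ < 1) : 0 ≤ gradedChainFactor θ := by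
  have h1 : (2 : ℝ) ^ θ < (2 : ℝ) ^ (1 : ℝ) := Real.rpow_lt_rpow_of_exponent_lt (by norm_num) hθ
  rw [Real.rpow_one] at h1
  unfold gradedChainFactor
  exact div_nonneg (by positivity) (by linarith)

/-- `(N+L₀)^θ ≤ 2^θ·N^θ` for `L₀ ≤ N`, `0 ≤ θ`. [folklore] -/
theorem cast_add_rpow_le {N L₀ : ℕ} {θ : ℝ} (hθ0 : 0 ≤ θ) (hL : L₀ ≤ N) :
    ((N + L₀ : ℕ) : ℝ) ^ θ ≤ (2 : ℝ) ^ θ * (N : ℝ) ^ θ := by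
  have hle2 : ((N + L₀ : ℕ) : ℝ) ≤ 2 * (N : ℝ) := by
    have : N + L₀ ≤ 2 * N := by omega
    exact_mod_cast this
  calc ((N + L₀ : ℕ) : ℝ) ^ θ ≤ (2 * (N : ℝ)) ^ θ := Real.rpow_le_rpow (by positivity) hle2 hθ0
    _ = (2 : ℝ) ^ θ * (N : ℝ) ^ θ := Real.mul_rpow (by norm_num) (by positivity)

/-- **Graded dichotomy at temperature `T`.**  Under the `θ`-defect buffered junction inequality at `T` (`0 ≤ θ < 1`, `C ≥ 0`): EITHER
`E_N(T) ≤ C₁/N` eventually (Ohmic at `T`), OR `1/E_N(T) ≤ K_θ·C·(N+L₀)^θ` for EVERY `N ≥ max N₂ 2, N ≥ L₀` (no good scale at all).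
[kernel] -/
theorem ohmicAt_or_resistancePowCapped_of_bufferedJunctionPowAt {ω₂ lam β γ T : ℝ} (hω : 0 < ω₂) (hl : 0 < lam) (hβ : 0 < β)
    (hγ : 0 < γ) (hT : 0 < T) {θ C : ℝ} {L₀ N₂ : ℕ} (hθ0 : 0 ≤ θ) (hθ : θ < 1) (hC : 0 ≤ C)
    (hJ : ∀ u v : ℕ, N₂ ≤ u → N₂ ≤ v →
      1 / escapeDeficit ω₂ lam β γ T u + 1 / escapeDeficit ω₂ lam β γ T v - C * ((u + L₀ + v : ℕ) : ℝ) ^ θ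
        ≤ 1 / escapeDeficit ω₂ lam β γ T (u + L₀ + v)) :
    (∃ C₁ : ℝ, ∃ N₀ : ℕ, ∀ N : ℕ, N₀ ≤ N → escapeDeficit ω₂ lam β γ T N ≤ C₁ / (N : ℝ)) ∨
      (∀ N : ℕ, max N₂ 2 ≤ N → L₀ ≤ N →
        1 / escapeDeficit ω₂ lam β γ T N ≤ gradedChainFactor θ * C * ((N + L₀ : ℕ) : ℝ) ^ θ) := by
  by_cases h : ∃ N : ℕ, max N₂ 2 ≤ N ∧ L₀ ≤ N ∧
      gradedChainFactor θ * C * ((N + L₀ : ℕ) : ℝ) ^ θ < 1 / escapeDeficit ω₂ lam β γ T N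
  · left
    obtain ⟨Ns, hNs, hL, hlt⟩ := h
    exact escapeFloor_one_of_bufferedJunctionPowAt_of_goodScale hω hl hβ hγ hT hθ0 hθ hC (sub_pos.2 hlt) hJ hNs hL
      (by linarith)
  · right
    exact fun N hN hL => not_lt.1 fun hlt => h ⟨N, hN, hL, hlt⟩

/-- **Graded dichotomy, law level.**  `BufferedJunctionLawPow θ` (`0 ≤ θ < 1`) ⟹ at every `T > 0`: Ohmic at `T`, OR `∃ A ≥ 0, N'`,
`1/E_N(T) ≤ A·N^θ` for all `N ≥ N'` — in the dictionary `D_N = (N−1)γ E_N`: `D_N ≥ (N−1)γ/(A N^θ)`, so NO anomalous exponent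
`D_N ≍ N^α` with `0 < α < 1 − θ` is compatible with a junction defect of exponent `θ` (`θ = 0`: file (10), Ohmic or ballistic). [kernel] -/
theorem ohmicAt_or_resistancePowCapped_of_bufferedJunctionLawPow {θ : ℝ} (hθ0 : 0 ≤ θ) (hθ : θ < 1)
    (hB : BufferedJunctionLawPow θ) :
    ∀ ω₂ lam β γ : ℝ, 0 < ω₂ → 0 < lam → 0 < β → 0 < γ → ∀ T : ℝ, 0 < T →
      (∃ C₁ : ℝ, ∃ N₀ : ℕ, ∀ N : ℕ, N₀ ≤ N → escapeDeficit ω₂ lam β γ T N ≤ C₁ / (N : ℝ)) ∨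
        (∃ A : ℝ, 0 ≤ A ∧ ∃ N' : ℕ, ∀ N : ℕ, N' ≤ N → 1 / escapeDeficit ω₂ lam β γ T N ≤ A * (N : ℝ) ^ θ) := by
  intro ω₂ lam β γ hω hl hβ hγ T hT
  obtain ⟨C, hC, L₀, N₂, hJ⟩ := hB ω₂ lam β γ hω hl hβ hγ T hT
  rcases ohmicAt_or_resistancePowCapped_of_bufferedJunctionPowAt hω hl hβ hγ hT hθ0 hθ hC hJ with h | h
  · exact Or.inl h
  · right
    have hK := gradedChainFactor_nonneg hθ
    refine ⟨gradedChainFactor θ * C * (2 : ℝ) ^ θ, by positivity, max (max N₂ 2) L₀, fun N hN => ?_⟩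
    have hL : L₀ ≤ N := le_trans (le_max_right _ _) hN
    calc 1 / escapeDeficit ω₂ lam β γ T N ≤ gradedChainFactor θ * C * ((N + L₀ : ℕ) : ℝ) ^ θ :=
          h N (le_trans (le_max_left _ _) hN) hL
      _ ≤ gradedChainFactor θ * C * ((2 : ℝ) ^ θ * (N : ℝ) ^ θ) :=
          mul_le_mul_of_nonneg_left (cast_add_rpow_le hθ0 hL) (mul_nonneg hK hC)
      _ = gradedChainFactor θ * C * (2 : ℝ) ^ θ * (N : ℝ) ^ θ := by ring

/-- **Node restated through the dichotomy**: `BufferedJunctionLawPow θ` and, at each `T`, ONE scale `N ≥ N'` with `A·N^θ < 1/E_N(T)` for every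
candidate cap `(A, N')` — i.e. `1/E_N(T) ≠ O(N^θ)` — give `11071`. [kernel · frame] -/
theorem boundedResponse_of_bufferedJunctionLawPow_of_notPowCapped {θ : ℝ} (hθ0 : 0 ≤ θ) (hθ : θ < 1)
    (hB : BufferedJunctionLawPow θ)
    (hnc : ∀ ω₂ lam β γ : ℝ, 0 < ω₂ → 0 < lam → 0 < β → 0 < γ → ∀ T : ℝ, 0 < T →
      ∀ A : ℝ, 0 ≤ A → ∀ N' : ℕ, ∃ N : ℕ, N' ≤ N ∧ A * (N : ℝ) ^ θ < 1 / escapeDeficit ω₂ lam β γ T N) :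
    BoundedResponse := by
  refine ohmicFloor_iff_boundedResponse.1 fun ω₂ lam β γ hω hl hβ hγ T hT => ?_
  rcases ohmicAt_or_resistancePowCapped_of_bufferedJunctionLawPow hθ0 hθ hB ω₂ lam β γ hω hl hβ hγ T hT with h | ⟨A, hA, N', hcap⟩
  · exact h
  · obtain ⟨N, hN, hlt⟩ := hnc ω₂ lam β γ hω hl hβ hγ T hT A hA N'
    exact absurd (hcap N hN) (not_le.2 hlt)

/-! ## Sharpness of the exponent range: no kernel at `θ = 1` -/

/-- The witness profile `g(x) = x·(S − C·log x)` obeys the free-split law with LINEAR defect: `g u + g v − C·(u+v) ≤ g(u+v)` for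
`u, v ≥ 0` (`u·log((u+v)/u) ≤ v` from `log t ≤ t − 1`). [folklore] -/
theorem witness_law_aux (S : ℝ) {C : ℝ} (hC : 0 ≤ C) {u v : ℝ} (hu : 0 ≤ u) (hv : 0 ≤ v) :
    u * (S - C * Real.log u) + v * (S - C * Real.log v) - C * (u + v) ≤ (u + v) * (S - C * Real.log (u + v)) := by
  rcases hu.eq_or_lt with rfl | hu'
  · simp only [zero_mul, zero_add]
    nlinarith
  rcases hv.eq_or_lt with rfl | hv'
  · simp only [zero_mul, add_zero]
    nlinarith
  have huv : 0 < u + v := add_pos hu' hv'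
  -- `u·(log(u+v) − log u) ≤ v` and `v·(log(u+v) − log v) ≤ u`
  have h1 : u * (Real.log (u + v) - Real.log u) ≤ v := by
    have hlog : Real.log ((u + v) / u) ≤ (u + v) / u - 1 := Real.log_le_sub_one_of_pos (div_pos huv hu')
    rw [Real.log_div huv.ne' hu'.ne'] at hlog
    have h := mul_le_mul_of_nonneg_left hlog hu'.le
    have e : u * ((u + v) / u - 1) = v := by field_simp; ring
    linarith [h, e]
  have h2 : v * (Real.log (u + v) - Real.log v) ≤ u := by
    have hlog : Real.log ((u + v) / v) ≤ (u + v) / v - 1 := Real.log_le_sub_one_of_pos (div_pos huv hv')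
    rw [Real.log_div huv.ne' hv'.ne'] at hlog
    have h := mul_le_mul_of_nonneg_left hlog hv'.le
    have e : v * ((u + v) / v - 1) = u := by field_simp; ring
    linarith [h, e]
  nlinarith [mul_le_mul_of_nonneg_left h1 hC, mul_le_mul_of_nonneg_left h2 hC]

/-- If `g u ≤ 0` with `u, v > 0` then `g v ≤ C·(u − v)` (`S ≤ C log u`, so `g v ≤ C·v·log(u/v) ≤ C(u − v)`). [folklore] -/
theorem witness_cross_aux {S C u v : ℝ} (hC : 0 ≤ C) (hu : 0 < u) (hv : 0 < v) (hgu : u * (S - C * Real.log u) ≤ 0) :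
    v * (S - C * Real.log v) ≤ C * (u - v) := by
  have hS : S - C * Real.log u ≤ 0 := by
    by_contra h
    exact absurd hgu (not_le.2 (mul_pos hu (not_le.1 h)))
  have hlog : Real.log (u / v) ≤ u / v - 1 := Real.log_le_sub_one_of_pos (div_pos hu hv)
  rw [Real.log_div hu.ne' hv.ne'] at hlog
  have h := mul_le_mul_of_nonneg_left hlog hv.le
  have e : v * (u / v - 1) = u - v := by field_simp
  have h3 : v * (Real.log u - Real.log v) ≤ u - v := by linarith [h, e]
  nlinarith [mul_le_mul_of_nonneg_left h3 hC, mul_le_mul_of_nonneg_left hS hv.le]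

/-- **Sharpness of `θ < 1`.**  At `θ = 1` no chain factor works: for every `K` and all `C, c > 0` the sequence
`r_N = max(N·(S − C·log N), 0)`, `S = |K|·C + c`, is nonnegative, obeys the free-split law with defect `C·(u + 0 + v)^1`, satisfies the good-scale
inequality `K·C·(1+0)^1 + c ≤ r_1`, and is NOT eventually bounded below by any `a·N`, `a > 0` (it vanishes for `N ≥ exp(S/C)`). [folklore] -/
theorem exists_defectOne_goodScale_not_linear (K : ℝ) {C c : ℝ} (hC : 0 < C) (hc : 0 < c) :
    ∃ r : ℕ → ℝ, (∀ n : ℕ, 0 ≤ r n) ∧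
      (∀ u v : ℕ, r u + r v - C * ((u + 0 + v : ℕ) : ℝ) ^ (1 : ℝ) ≤ r (u + 0 + v)) ∧
      (K * C * ((1 + 0 : ℕ) : ℝ) ^ (1 : ℝ) + c ≤ r 1) ∧
      (∀ a : ℝ, 0 < a → ∀ N₀ : ℕ, ∃ N : ℕ, N₀ ≤ N ∧ r N < a * N) := by
  set S : ℝ := |K| * C + c with hS
  set g : ℝ → ℝ := fun x => x * (S - C * Real.log x) with hg
  refine ⟨fun n => max (g n) 0, fun n => le_max_right _ _, fun u v => ?_, ?_, fun a ha N₀ => ?_⟩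
  · -- the law
    simp only [Nat.add_zero, Real.rpow_one, Nat.cast_add]
    have hu : (0 : ℝ) ≤ u := Nat.cast_nonneg u
    have hv : (0 : ℝ) ≤ v := Nat.cast_nonneg v
    have hlaw := witness_law_aux S hC.le hu hv
    rcases le_or_gt (g u) 0 with hgu | hgu <;> rcases le_or_gt (g v) 0 with hgv | hgv
    · rw [max_eq_right hgu, max_eq_right hgv]
      exact le_trans (by nlinarith) (le_max_right _ _)
    · rw [max_eq_right hgu, max_eq_left hgv.le]
      rcases hu.eq_or_lt with hu0 | hu'
      · -- `u = 0`: `g v − C v ≤ g v = g (0 + v)`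
        have hu0' : (u : ℝ) = 0 := hu0.symm
        simp only [hu0', zero_add]
        exact le_trans (by nlinarith) (le_max_left _ _)
      · have hv' : (0 : ℝ) < v := by
          rcases hv.eq_or_lt with hv0 | hv0
          · exfalso; rw [← hv0] at hgv; simp [hg] at hgv
          · exact hv0
        have hx := witness_cross_aux hC.le hu' hv' hgu
        exact le_trans (by nlinarith) (le_max_right _ _)
    · rw [max_eq_left hgu.le, max_eq_right hgv]
      rcases hv.eq_or_lt with hv0 | hv'
      · have hv0' : (v : ℝ) = 0 := hv0.symm
        simp only [hv0', add_zero]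
        exact le_trans (by nlinarith) (le_max_left _ _)
      · have hu' : (0 : ℝ) < u := by
          rcases hu.eq_or_lt with hu0 | hu0
          · exfalso; rw [← hu0] at hgu; simp [hg] at hgu
          · exact hu0
        have hx := witness_cross_aux hC.le hv' hu' hgv
        exact le_trans (by nlinarith) (le_max_right _ _)
    · rw [max_eq_left hgu.le, max_eq_left hgv.le]
      exact le_trans hlaw (le_max_left _ _)
  · -- the good scale at `N⋆ = 1`
    have h1 : g 1 = S := by simp [hg]
    simp only [Nat.add_zero, Nat.cast_one, Real.rpow_one, mul_one]
    rw [h1, max_eq_left (by positivity)]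
    have hK : K * C ≤ |K| * C := mul_le_mul_of_nonneg_right (le_abs_self K) hC.le
    linarith
  · -- no linear growth: `r_N = 0` once `log N ≥ S/C`
    obtain ⟨P, hP⟩ := exists_nat_ge (Real.exp (S / C))
    refine ⟨max N₀ (max P 1), le_max_left _ _, ?_⟩
    set N := max N₀ (max P 1) with hN
    have hN1 : (1 : ℝ) ≤ N := by exact_mod_cast le_trans (le_max_right P 1) (le_max_right _ _)
    have hNP : Real.exp (S / C) ≤ N := le_trans hP (by exact_mod_cast le_trans (le_max_left P 1) (le_max_right _ _))
    have hlog : S / C ≤ Real.log N := by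
      have h := Real.log_le_log (Real.exp_pos _) hNP
      rwa [Real.log_exp] at h
    have hS' : S ≤ C * Real.log N := by
      have h := mul_le_mul_of_nonneg_left hlog hC.le
      rwa [mul_div_cancel₀ _ hC.ne'] at h
    have hgN : g N ≤ 0 := by
      show (N : ℝ) * (S - C * Real.log N) ≤ 0
      exact mul_nonpos_of_nonneg_of_nonpos (by positivity) (by linarith)
    show max (g N) 0 < a * N
    rw [max_eq_right hgN]
    positivity

/-- **Corollary: `linear_of_bufferedJunctionPow_of_goodScale` has no `θ = 1` analogue, whatever the chain factor.**  For every `K` the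
`θ = 1` kernel statement (hypotheses of the graded kernel with `θ := 1` and `K` in place of `K_θ`) is FALSE. [folklore] -/
theorem not_linear_kernel_at_one (K : ℝ) :
    ¬ ∀ (r : ℕ → ℝ) (C c : ℝ) (L₀ N₂ Ns : ℕ), 0 ≤ C → 0 < c → (∀ n : ℕ, N₂ ≤ n → 0 ≤ r n) →
      (∀ u v : ℕ, N₂ ≤ u → N₂ ≤ v → r u + r v - C * ((u + L₀ + v : ℕ) : ℝ) ^ (1 : ℝ) ≤ r (u + L₀ + v)) →
      N₂ ≤ Ns → 1 ≤ Ns → L₀ ≤ Ns → K * C * ((Ns + L₀ : ℕ) : ℝ) ^ (1 : ℝ) + c ≤ r Ns →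
      ∃ a : ℝ, 0 < a ∧ ∃ N₀ : ℕ, ∀ N : ℕ, N₀ ≤ N → a * (N : ℝ) ≤ r N := by
  intro h
  obtain ⟨r, h0, hJ, hgood, hfail⟩ := exists_defectOne_goodScale_not_linear K one_pos one_pos
  obtain ⟨a, ha, N₀, hlin⟩ := h r 1 1 0 0 1 zero_le_one one_pos (fun n _ => h0 n) (fun u v _ _ => hJ u v) (Nat.zero_le _) le_rfl
    (Nat.zero_le _) hgood
  obtain ⟨N, hN, hlt⟩ := hfail a ha N₀
  exact absurd (hlin N hN) (not_le.2 hlt)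

end EscapeGrading

end Summit.AtomisticToContinuum.FouriersLaw.Theorems.SubdiffusiveBondHeat

end
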